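import Summits.CriticalPhenomena.PercolationContinuityZ3.Theorems.PercNearOneGluingNoHeavyLowerTailSahiC3ThreePointLaw
import HarnessLib

/-!
# `NoHeavyLowerTail` (stmt-CriticalPhenomena-4575) — Sahi's `C₃` on the three-point connectivity algebra, V: event form on the
# percolation space

Support file (prover prim-sahi-p2 gen 3; `--supports stmt-CriticalPhenomena-4575`).  No named facts, no sorries.

For `μ = prodBernoulli w` and vertices `a b c`, Sahi's functional `sahiE3 μ` [LiebSahi2021, eq. (2.1)] is nonnegative on EVERY triple of
events of the form `pattern a b c ⁻¹' U` with `U, V, W` all upper sets (increasing connectivity events) or all lower sets (decreasing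
connectivity events) of the pattern lattice `M₃` — `sahiE3_pattern_upper_nonneg`, `sahiE3_pattern_lower_nonneg`.  These contain as the two
irreducible instances `TIncSwitching.sahiE3_nonIsol_nonneg` and `ThreePointLB.sahiE3_pairSep_nonneg`, and the `238` Harris-reducible ones
(prim-ineq-prove-2 MEMO-6), e.g. every three-terminal E3GRP-type row.  Proof: masses of pattern events (`real_pattern_preimage`) and the
indicator theorems of file IV.
-/

noncomputable section

namespace Summit.CriticalPhenomena.PercolationContinuityZ3.Theorems

namespace SahiC3ThreePoint

open MeasureTheory Literature.Probability.Percolation Literature.Probability.LatticeModels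
open Literature.Combinatorics.Sahi2008

variable {V : Type*} [Fintype V] (w : Sym2 V → unitInterval) (a b c : V)

/-- `sahiE3` of three pattern events equals Sahi's `E₃` of the three indicator functions under the pattern law. [this work] -/
theorem sahiE3_pattern_eq (U₀ U₁ U₂ : Finset M3) :
    sahiE3 (prodBernoulli w) (pattern a b c ⁻¹' (U₀ : Set M3)) (pattern a b c ⁻¹' (U₁ : Set M3)) (pattern a b c ⁻¹' (U₂ : Set M3)) =
      sahiE (cell w (pattern a b c)) 3 (fun i => setInd ((![U₀, U₁, U₂] : Fin 3 → Finset M3) i)) := by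
  classical
  rw [sahiE3_def, sahiE_three_apply]
  simp only [Matrix.cons_val_zero, Matrix.cons_val_one, Matrix.cons_val, setInd_mul, ex_setInd,
    ← Set.preimage_inter, ← Finset.coe_inter, real_pattern_preimage]

/-- **Sahi's `C₃` for every triple of INCREASING three-point connectivity events**: `0 ≤ E₃(π⁻¹U, π⁻¹V, π⁻¹W)` for upper sets
`U V W` of `M₃`, `π = pattern a b c`, `μ = prodBernoulli w`. [this work] -/
theorem sahiE3_pattern_upper_nonneg (U₀ U₁ U₂ : Finset M3) (h₀ : IsUpperSet (U₀ : Set M3)) (h₁ : IsUpperSet (U₁ : Set M3))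
    (h₂ : IsUpperSet (U₂ : Set M3)) :
    0 ≤ sahiE3 (prodBernoulli w) (pattern a b c ⁻¹' (U₀ : Set M3)) (pattern a b c ⁻¹' (U₁ : Set M3))
      (pattern a b c ⁻¹' (U₂ : Set M3)) := by
  rw [sahiE3_pattern_eq]
  refine sahiE_three_nonneg_of_upperSets w a b c _ fun i => ?_
  fin_cases i
  · exact h₀
  · exact h₁
  · exact h₂

/-- **Sahi's `C₃` for every triple of DECREASING three-point connectivity events**: `0 ≤ E₃(π⁻¹U, π⁻¹V, π⁻¹W)` for lower sets
`U V W` of `M₃`. [this work] -/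
theorem sahiE3_pattern_lower_nonneg (U₀ U₁ U₂ : Finset M3) (h₀ : IsLowerSet (U₀ : Set M3)) (h₁ : IsLowerSet (U₁ : Set M3))
    (h₂ : IsLowerSet (U₂ : Set M3)) :
    0 ≤ sahiE3 (prodBernoulli w) (pattern a b c ⁻¹' (U₀ : Set M3)) (pattern a b c ⁻¹' (U₁ : Set M3))
      (pattern a b c ⁻¹' (U₂ : Set M3)) := by
  rw [sahiE3_pattern_eq]
  refine sahiE_three_nonneg_of_lowerSets w a b c _ fun i => ?_
  fin_cases i
  · exact h₀
  · exact h₁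
  · exact h₂

end SahiC3ThreePoint

end Summit.CriticalPhenomena.PercolationContinuityZ3.Theorems

end
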